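import Literature.Computability.Complexity.PaulPippengerSzemerediTrotter1983Blocks
import Literature.Computability.Complexity.TM2ToStackProgram
import HarnessLib

/-!
# Flat binary programs as `TM2` machines with stateless step boundaries (PPST 1983, §3)

Literature / complexity toolkit, fifteenth brick of the inline formalization of
Paul–Pippenger–Szemerédi–Trotter 1983 (`PaulPippengerSzemerediTrotter1983.lean`, fact
`PaulEtAl1983_NTIME_not_subset_DTIME`; roadmap Layer 4, machines, part 2). The block theory
(`…Blocks.lean` … `…Protocol.lean`) is about runs `TM2Blocks.run tm c₀` of a `Turing.FinTM2`; the
machines it will be applied to are flat binary stack programs `P : AProg Bool (Fin K)`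
(`SymbolPrograms.lean`), into which every `TM2` decider compiles with linear overhead
(`TM2ToStackProgram.lean`). `SymbolPrograms.lean` already packages `P` as a `FinTM2`
(`AProg.tm`), but with the popped symbol lingering in the internal state across steps; the
four-alternation protocol claims the internal state at block boundaries, and its checker
re-simulates `P` itself (`…Interp.lean`), which knows nothing of lingering states. So we package
`P` anew with STATELESS BOUNDARIES: every step ends by resetting the state to `none`, branching on
a popped symbol through a decision tree of constant jumps:

* `FlatN.addr`, `FlatN.trInstrN`, **`FlatN.tmN P hP inp out`**, `FlatN.cfgN`
  (`⟨label of pc, none, registers⟩`);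
* **`FlatN.stepT_cfgN`**, **`FlatN.run_cfgN`**: `TM2Blocks.run (tmN P …) (cfgN c) s = cfgN (P.step^[s] c)`
  — the run of the packaged machine IS the iteration of `P.step`, halting included;
* `FlatN.machinePopBound_le`, `FlatN.machinePushBound_le` (both `≤ 1`);
* `FlatN.trapProg P out` — `P` followed by "pop the output bit and enter one of two trap loops",
  so that the ANSWER of a decider becomes visible in the label (light data) for ever after:
  `trapProg_step_of_lt`, `iterate_trapProg_of_lt`, `trapProg_traps`.

No named fact is introduced (definitions with bodies and theorems only).

## References

* W. J. Paul, N. Pippenger, E. Szemerédi, W. T. Trotter, *On determinism versus non-determinism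
  and related problems*, FOCS 1983, 429–438, §3 [PaulEtAl1983].
* M. L. Minsky, *Computation: Finite and Infinite Machines*, Prentice-Hall 1967, §14.1
  (push-down registers) [folklore].
-/

namespace Literature.Computability.Complexity

open Turing Function

namespace FlatN

variable {K : ℕ} (P : AProg Bool (Fin K)) (hP : 0 < P.length) (inp out : Fin K)

/-- Jump to address `n`, resetting the state: a label if `n < |P|`, else halt. [folklore] -/
def addr (n : ℕ) : TM2.Stmt (fun _ : Fin K => Bool) (Fin P.length) (Option Bool) :=
  if h : n < P.length then .load (fun _ => none) (.goto fun _ => ⟨n, h⟩)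
  else .load (fun _ => none) .halt

/-- Translation of one instruction at address `pc`, with stateless boundary. [folklore] -/
def trInstrN (pc : ℕ) : AInstr Bool (Fin K) → TM2.Stmt (fun _ : Fin K => Bool) (Fin P.length) (Option Bool)
  | .push k a => .push k (fun _ => a) (addr P (pc + 1))
  | .goto j => addr P j
  | .pop k j => .pop k (fun _ o => o)
      (.branch (fun v => decide (v = some true)) (addr P (j (some true)))
        (.branch (fun v => decide (v = some false)) (addr P (j (some false))) (addr P (j none))))

/-- **The `TM2` machine of a flat binary program, with stateless step boundaries.** [folklore] -/
@[reducible] def tmN : FinTM2 where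
  K := Fin K
  k₀ := inp
  k₁ := out
  Γ := fun _ => Bool
  Λ := Fin P.length
  main := ⟨0, hP⟩
  σ := Option Bool
  initialState := none
  m := fun l => trInstrN P l.val (P[l.val]'l.isLt)

/-- The label of an address (`none` beyond the program). [folklore] -/
def lbl (pc : ℕ) : Option (Fin P.length) := if h : pc < P.length then some ⟨pc, h⟩ else none

/-- The machine configuration of a flat configuration. [folklore] -/
def cfgN (c : ACfg Bool (Fin K)) : (tmN P hP inp out).Cfg := ⟨lbl P c.pc, none, c.regs⟩

/-- Semantics of `addr`. [folklore] -/
theorem stepAux_addr (n : ℕ) (v : Option Bool) (S : ∀ _ : Fin K, List Bool) :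
    TM2.stepAux (addr P n) v S = ⟨lbl P n, none, S⟩ := by
  unfold addr lbl
  by_cases h : n < P.length
  · simp [h]
  · simp [h]

/-- **One flat step is one machine step** (inside the program). [folklore] -/
theorem step_cfgN (c : ACfg Bool (Fin K)) (hc : c.pc < P.length) :
    (tmN P hP inp out).step (cfgN P hP inp out c) = some (cfgN P hP inp out (P.step c)) := by
  obtain ⟨pc, R⟩ := c
  change pc < P.length at hc
  set ins : AInstr Bool (Fin K) := P[pc]'hc with hins
  have hget : P[pc]? = some ins := by rw [hins]; exact List.getElem?_eq_getElem hc
  have hl : lbl P pc = some ⟨pc, hc⟩ := by simp [lbl, hc]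
  have hstep : (tmN P hP inp out).step (cfgN P hP inp out ⟨pc, R⟩) =
      some (TM2.stepAux (trInstrN P pc ins) none R) := by
    simp only [FinTM2.step, cfgN, hl, hins]
    rfl
  clear_value ins
  rw [hstep, P.step_of_getElem? hget]
  cases ins with
  | push k a =>
    simp only [trInstrN, TM2.stepAux, stepAux_addr]
    rfl
  | goto j =>
    simp only [trInstrN, stepAux_addr]
    rfl
  | pop k j =>
    simp only [trInstrN, TM2.stepAux]
    rcases hR : R k with _ | ⟨a, w⟩
    · have hu : update R k [] = R := Function.update_eq_self_iff.2 hR.symm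
      simp only [List.head?_nil, List.tail_nil, stepAux_addr, hu]
      simp
      rfl
    · cases a
      · simp only [List.head?_cons, List.tail_cons, stepAux_addr]
        simp
        rfl
      · simp only [List.head?_cons, List.tail_cons, stepAux_addr]
        simp
        rfl

/-- **The total step of the packaged machine is `P.step`**, halting included. [folklore] -/
theorem stepT_cfgN (c : ACfg Bool (Fin K)) :
    TM2Blocks.stepT (tmN P hP inp out) (cfgN P hP inp out c) = cfgN P hP inp out (P.step c) := by
  unfold TM2Blocks.stepT
  by_cases hc : c.pc < P.length
  · rw [step_cfgN P hP inp out c hc]; rfl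
  · have hl : lbl P c.pc = none := by simp [lbl, hc]
    rw [P.step_of_le (Nat.le_of_not_lt hc)]
    simp only [FinTM2.step, cfgN, hl, TM2.step]
    rfl

/-- **The run of the packaged machine is the iteration of `P.step`.** [folklore] -/
theorem run_cfgN (c : ACfg Bool (Fin K)) (s : ℕ) :
    TM2Blocks.run (tmN P hP inp out) (cfgN P hP inp out c) s = cfgN P hP inp out (P.step^[s] c) := by
  induction s generalizing c with
  | zero => rfl
  | succ s ih =>
    unfold TM2Blocks.run at ih ⊢
    rw [Function.iterate_succ_apply, stepT_cfgN, ih, ← Function.iterate_succ_apply]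

/-! ### Pops and pushes per step -/

/-- `addr` neither pops nor pushes. [folklore] -/
theorem popBound_addr (n : ℕ) : TM2Comp.popBound (addr P n) = 0 := by
  unfold addr; split_ifs <;> rfl

/-- `addr` neither pops nor pushes. [folklore] -/
theorem pushBound_addr (n : ℕ) : TM2Comp.pushBound (addr P n) = 0 := by
  unfold addr; split_ifs <;> rfl

/-- One pop per step at most. [folklore] -/
theorem popBound_trInstrN (pc : ℕ) (ins : AInstr Bool (Fin K)) :
    TM2Comp.popBound (trInstrN P pc ins) ≤ 1 := by
  cases ins <;> simp [trInstrN, TM2Comp.popBound, popBound_addr]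

/-- One push per step at most. [folklore] -/
theorem pushBound_trInstrN (pc : ℕ) (ins : AInstr Bool (Fin K)) :
    TM2Comp.pushBound (trInstrN P pc ins) ≤ 1 := by
  cases ins <;> simp [trInstrN, TM2Comp.pushBound, pushBound_addr]

/-- `Q ≤ 1` for the packaged machine. [folklore] -/
theorem machinePopBound_le : TM2Comp.machinePopBound (tmN P hP inp out) ≤ 1 := by
  unfold TM2Comp.machinePopBound
  exact Finset.sup_le fun l _ => popBound_trInstrN P l.val _

/-- `P ≤ 1` for the packaged machine. [folklore] -/
theorem machinePushBound_le : TM2Comp.machinePushBound (tmN P hP inp out) ≤ 1 := by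
  unfold TM2Comp.machinePushBound
  exact Finset.sup_le fun l _ => pushBound_trInstrN P l.val _

/-! ### Trap loops: making the answer of a decider visible in the label -/

/-- The address of the `true` trap. [folklore] -/
def trapT : ℕ := P.length + 1

/-- The address of the `false` trap. [folklore] -/
def trapF : ℕ := P.length + 2

/-- **`P` followed by "pop the output and loop for ever at `trapT` / `trapF`"** (at `trapT` iff
the popped bit was `true`). [folklore] -/
def trapProg : AProg Bool (Fin K) :=
  P ++ [.pop out fun o => if o = some true then P.length + 1 else P.length + 2,
    .goto (P.length + 1), .goto (P.length + 2)]

/-- Length of the trapped program. [folklore] -/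
@[simp] theorem length_trapProg : (trapProg P out).length = P.length + 3 := by
  simp [trapProg]

/-- Inside `P`, the trapped program steps as `P`. [folklore] -/
theorem trapProg_step_of_lt (c : ACfg Bool (Fin K)) (hc : c.pc < P.length) :
    (trapProg P out).step c = P.step c := by
  obtain ⟨pc, R⟩ := c
  change pc < P.length at hc
  have h1 : (trapProg P out)[pc]? = P[pc]? := by
    unfold trapProg; exact List.getElem?_append_left hc
  obtain ⟨ins, hins⟩ : ∃ ins, P[pc]? = some ins := ⟨P[pc], List.getElem?_eq_getElem hc⟩
  rw [AProg.step_of_getElem? _ (h1.trans hins), AProg.step_of_getElem? _ hins]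
  cases ins <;> rfl

/-- While `P` has not halted, the trapped program runs as `P`. [folklore] -/
theorem iterate_trapProg_of_lt (c : ACfg Bool (Fin K)) :
    ∀ t, (∀ m, m < t → (P.step^[m] c).pc < P.length) →
      (trapProg P out).step^[t] c = P.step^[t] c
  | 0, _ => rfl
  | t + 1, h => by
    rw [Function.iterate_succ_apply', Function.iterate_succ_apply',
      iterate_trapProg_of_lt c t fun m hm => h m (by omega)]
    exact trapProg_step_of_lt P out _ (h t (Nat.lt_succ_self t))

/-- The trap address of a bit. [folklore] -/
def trapOf (b : Bool) : ℕ := if b then P.length + 1 else P.length + 2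

/-- **The traps**: from `⟨|P|, out ↦ [b], all else empty⟩`, after `2 + s` steps the trapped
program sits at `trapOf b` with all registers empty. [folklore] -/
theorem trapProg_traps (b : Bool) (s : ℕ) :
    (trapProg P out).step^[2 + s] ⟨P.length, AStore.single out [b]⟩ =
      ⟨trapOf P b, fun _ => []⟩ := by
  have h0 : (trapProg P out)[P.length]? =
      some (.pop out fun o => if o = some true then P.length + 1 else P.length + 2) := by
    simp [trapProg]
  have h1 : (trapProg P out)[P.length + 1]? = some (.goto (P.length + 1)) := by
    simp [trapProg]
  have h2 : (trapProg P out)[P.length + 2]? = some (.goto (P.length + 2)) := by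
    simp [trapProg, show P.length + 2 - P.length = 2 from by omega]
  have hempty : update (AStore.single out [b]) out [] = fun _ : Fin K => ([] : List Bool) := by
    funext i; by_cases hi : i = out
    · subst hi; simp
    · simp [AStore.single, hi]
  -- first step: the pop
  have hs1 : (trapProg P out).step ⟨P.length, AStore.single out [b]⟩ = ⟨trapOf P b, fun _ => []⟩ := by
    rw [AProg.step_of_getElem? _ h0]
    simp only [AStore.single_self]
    rw [hempty]
    cases b <;> simp [trapOf]
  -- then the trap loops
  have hfix : ∀ s, (trapProg P out).step^[s] ⟨trapOf P b, fun _ => []⟩ = ⟨trapOf P b, fun _ => []⟩ := by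
    intro s
    induction s with
    | zero => rfl
    | succ s ih =>
      rw [Function.iterate_succ_apply', ih]
      cases b
      · rw [show trapOf P false = P.length + 2 from rfl, AProg.step_of_getElem? _ h2]
      · rw [show trapOf P true = P.length + 1 from rfl, AProg.step_of_getElem? _ h1]
  rw [show 2 + s = (s + 1) + 1 from by omega, Function.iterate_succ_apply, hs1, hfix]

/-- **The traps, from an empty store** (a rejecting decider leaves `encodeBool false = ε`):
after `2 + s` steps the trapped program sits at `trapOf false`. [folklore] -/
theorem trapProg_traps_empty (s : ℕ) :
    (trapProg P out).step^[2 + s] ⟨P.length, fun _ => []⟩ = ⟨trapOf P false, fun _ => []⟩ := by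
  have h0 : (trapProg P out)[P.length]? =
      some (.pop out fun o => if o = some true then P.length + 1 else P.length + 2) := by
    simp [trapProg]
  have h2 : (trapProg P out)[P.length + 2]? = some (.goto (P.length + 2)) := by
    simp [trapProg, show P.length + 2 - P.length = 2 from by omega]
  have hs1 : (trapProg P out).step ⟨P.length, fun _ => []⟩ = ⟨trapOf P false, fun _ => []⟩ := by
    rw [AProg.step_of_getElem? _ h0]
    simp [trapOf]
  have hfix : ∀ s, (trapProg P out).step^[s] ⟨trapOf P false, fun _ => []⟩ = ⟨trapOf P false, fun _ => []⟩ := by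
    intro s
    induction s with
    | zero => rfl
    | succ s ih =>
      rw [Function.iterate_succ_apply', ih, show trapOf P false = P.length + 2 from rfl,
        AProg.step_of_getElem? _ h2]
  rw [show 2 + s = (s + 1) + 1 from by omega, Function.iterate_succ_apply, hs1, hfix]

/-- `AStore.single k ε` is the empty store. [folklore] -/
theorem single_nil {K : ℕ} (k : Fin K) : AStore.single k ([] : List Bool) = fun _ => [] := by
  funext i; by_cases hi : i = k
  · subst hi; simp
  · simp [AStore.single, hi]

/-- The traps are inside the trapped program (labels, not halting). [folklore] -/
theorem trapOf_lt (b : Bool) : trapOf P b < (trapProg P out).length := by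
  cases b <;> simp [trapOf]

/-- The two traps differ. [folklore] -/
theorem trapOf_injective : Function.Injective (trapOf P) := by
  intro a b h; cases a <;> cases b <;> simp [trapOf] at h ⊢

end FlatN

end Literature.Computability.Complexity
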